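import Mathlib
import Summits.Ventures.PercRepro2.ZMeanProof
import Summits.Ventures.PercRepro2.PendantRoot
import Summits.Ventures.PercRepro2.A3LeafQuadratic
import Summits.Ventures.PercRepro2.HMFLeaf
import Summits.Ventures.PercRepro2.HMFPendantBEvents
import Summits.Ventures.PercRepro2.HMFPendantB
import Summits.Ventures.PercRepro2.HMFLeafStep
import Summits.Ventures.PercRepro2.HMFLeafIso
import Summits.Ventures.PercRepro2.HMFLeafRB
import Summits.Ventures.PercRepro2.HMFLeafRB2
import Summits.Ventures.PercRepro2.XhatRB

/-!
# The (HMF) leaf coefficient as a Rao–Blackwell cross covariance (blind cell PercRepro2, night-1 g7;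
NIGHT1-G7.md §2)

Combining `HMFLeafStep.kappa_eq_split` (the coupling-mass form (K′) of `κ = 4 HMFc(½) − 2 HMFc(1)`)
with `XhatRB.Xhat_eq_rb` (the mean field is a Rao–Blackwell sum) gives, on the contracted instance
`p[f ↦ 1]` with `x_W(X) = P({C(a₃) = W} ∩ Q ∩ X)`, `z_W = P({C(a₃) = W} ∩ Q)`:

  `κ = −2 P(T ∪ T′) · C_cross + 2Z · [P(T ∪ T′) · S_T − P(T ∪ T′, oU) · (P(T, bL) + P(T′, bH))]
       + 2 (B_H − B_L) · [P(T, oU) P(T′) − P(T′, oU) P(T)]`,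

where `C_cross = Z · Σ_W [x_W(oL) x_W(bH) + x_W(oH) x_W(bL)] / z_W − (A_L B_H + A_H B_L)` is the cleared
sum of the two Rao–Blackwell CROSS covariances of row 2′RB (`= Z² [Cov_ν(ôL, b̂H) + Cov_ν(ôH, b̂L)]`, `ν`
the law of `C(a₃)` under `μ = P(· | Q)`), and `S_T = Σ_{T-type W} [x_W(oH ∧ bL) + x_W(oL) x_W(bL) / z_W]
+ Σ_{T′-type W} [x_W(oL ∧ bH) + x_W(oH) x_W(bH) / z_W]` collects the `T/T′` rows (`= Z ·
E_ν[1_{y ∈ U} · μ(b opposite to y | W) · μ(o ∈ U | W)]`).  So (ATT-y), `κ ≥ 0`, is the statement that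
the RB-cross covariance along `C(y)` pays for the `T/T′` coupling terms (NIGHT1-G7.md §2, (D1)).
-/

namespace Summit.Ventures.PercRepro2

open UnionCluster CovForm PendantRoot HMFPendantRoot HMFPendantB XhatRB

namespace XhatRB

variable {V : Type*} {E : Type*} [Fintype E] [DecidableEq E] [Fintype V] [DecidableEq V]
  {R : Type*} [Field R] [LinearOrder R] [IsStrictOrderedRing R]

variable (p : E → R) (ends : E → Sym2 V) (o a₁ a₂ a₃ b : V)

/-- The Rao–Blackwell cross term of the cluster `W`: `[x_W(oL) x_W(bH) + x_W(oH) x_W(bL)] / z_W`. -/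
noncomputable def crossTerm (W : Finset V) : R :=
  (prob p (clQ ends a₁ a₂ a₃ W ∩ connEvent ends a₁ o) *
        prob p (clQ ends a₁ a₂ a₃ W ∩ connEvent ends a₂ b) +
      prob p (clQ ends a₁ a₂ a₃ W ∩ connEvent ends a₂ o) *
        prob p (clQ ends a₁ a₂ a₃ W ∩ connEvent ends a₁ b)) / prob p (clQ ends a₁ a₂ a₃ W)

/-- The `T/T′` correction of the cluster `W`: `x_W(oH ∧ bL) + x_W(oL) x_W(bL) / z_W` on T-type clusters
(`a₂ ∈ W ∌ a₁`), the mirror on T′-type clusters, `0` otherwise. -/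
noncomputable def tTerm (W : Finset V) : R :=
  if a₁ ∈ W then
    (if a₂ ∈ W then 0 else
      prob p (clQ ends a₁ a₂ a₃ W ∩ (connEvent ends a₁ o ∩ connEvent ends a₂ b)) +
        prob p (clQ ends a₁ a₂ a₃ W ∩ connEvent ends a₂ o) *
          prob p (clQ ends a₁ a₂ a₃ W ∩ connEvent ends a₂ b) / prob p (clQ ends a₁ a₂ a₃ W))
  else
    (if a₂ ∈ W then
      prob p (clQ ends a₁ a₂ a₃ W ∩ (connEvent ends a₂ o ∩ connEvent ends a₁ b)) +
        prob p (clQ ends a₁ a₂ a₃ W ∩ connEvent ends a₁ o) *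
          prob p (clQ ends a₁ a₂ a₃ W ∩ connEvent ends a₁ b) / prob p (clQ ends a₁ a₂ a₃ W)
    else 0)

section PerCluster

variable {p}

omit [Fintype E] [DecidableEq E] [Fintype V] in
/-- On a T-type cluster (`a₂ ∈ W`), `{b ↔ a₂}` is `clQ` itself or empty according to `b ∈ W`. -/
lemma clQ_inter_conn_root_mem {W : Finset V} (h2 : a₂ ∈ W) (v : V) :
    clQ ends a₁ a₂ a₃ W ∩ connEvent ends a₂ v =
      if v ∈ W then clQ ends a₁ a₂ a₃ W else ∅ := by
  unfold clQ
  split_ifs with hv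
  · rw [Set.inter_right_comm, cl_inter_conn_of_mem_mem ends a₃ (↑W : Set V) (by simpa using h2) (by simpa using hv)]
  · rw [Set.inter_right_comm, cl_inter_conn_eq_empty' ends a₃ (↑W : Set V) (by simpa using h2) (by simpa using hv),
      Set.empty_inter]

omit [Fintype E] [DecidableEq E] [Fintype V] in
/-- On a T′-type cluster (`a₁ ∈ W`), `{b ↔ a₁}` is `clQ` itself or empty according to `b ∈ W`. -/
lemma clQ_inter_conn_root_mem' {W : Finset V} (h1 : a₁ ∈ W) (v : V) :
    clQ ends a₁ a₂ a₃ W ∩ connEvent ends a₁ v =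
      if v ∈ W then clQ ends a₁ a₂ a₃ W else ∅ := by
  unfold clQ
  split_ifs with hv
  · rw [Set.inter_right_comm, cl_inter_conn_of_mem_mem ends a₃ (↑W : Set V) (by simpa using h1) (by simpa using hv)]
  · rw [Set.inter_right_comm, cl_inter_conn_eq_empty' ends a₃ (↑W : Set V) (by simpa using h1) (by simpa using hv),
      Set.empty_inter]

omit [Fintype V] in
/-- **Per cluster**: `rbTerm = crossTerm − tTerm`. -/
theorem rbTerm_eq (hp : IsProbVec p) (W : Finset V) :
    rbTerm p ends o a₁ a₂ a₃ b W = crossTerm p ends o a₁ a₂ a₃ b W - tTerm p ends o a₁ a₂ a₃ b W := by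
  unfold rbTerm crossTerm tTerm
  by_cases h1 : a₁ ∈ W
  · by_cases h2 : a₂ ∈ W
    · -- both roots in `W`: `clQ = ∅`
      simp only [h1, h2, if_true]
      have hQ : clQ ends a₁ a₂ a₃ W = ∅ := by
        unfold clQ
        rw [avoidAll_eq_compl]
        ext ω
        simp only [Set.mem_inter_iff, mem_clusterEvent, Set.mem_compl_iff, mem_connEvent, Set.mem_empty_iff_false, iff_false, not_and, not_not]
        intro hS
        exact conn_trans (conn_symm ((conn_iff_mem_of_cluster_eq hS a₁).2 (by simpa using h1)))
          ((conn_iff_mem_of_cluster_eq hS a₂).2 (by simpa using h2))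
      simp [hQ, prob_empty]
    · simp only [h1, h2, if_true, if_false]
      -- T′-type: `x(oL) = z·1[o∈W]`, `x(bL) = z·1[b∈W]`
      have ho := clQ_inter_conn_root_mem' ends a₁ a₂ a₃ h1 o
      have hb := clQ_inter_conn_root_mem' ends a₁ a₂ a₃ h1 b
      have hjoint : clQ ends a₁ a₂ a₃ W ∩ (connEvent ends a₂ o ∩ connEvent ends a₁ b) =
          if b ∈ W then clQ ends a₁ a₂ a₃ W ∩ connEvent ends a₂ o else ∅ := by
        rw [← Set.inter_assoc, Set.inter_right_comm, hb]
        split_ifs <;> simp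
      have hjoint2 : clQ ends a₁ a₂ a₃ W ∩ (connEvent ends a₁ o ∩ connEvent ends a₂ b) =
          if o ∈ W then clQ ends a₁ a₂ a₃ W ∩ connEvent ends a₂ b else ∅ := by
        rw [← Set.inter_assoc, ho]
        split_ifs <;> simp
      rw [ho, hb, hjoint, hjoint2]
      by_cases hoW : o ∈ W <;> by_cases hbW : b ∈ W <;>
        simp only [hoW, hbW, if_true, if_false, prob_empty, zero_mul, mul_zero, zero_div, add_zero, zero_add] <;>
        (by_cases hz : prob p (clQ ends a₁ a₂ a₃ W) = 0
         · have h0 : ∀ X : Set (Config E), prob p (clQ ends a₁ a₂ a₃ W ∩ X) = 0 := fun X =>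
             le_antisymm (by rw [← hz]; exact prob_mono hp Set.inter_subset_left) (prob_nonneg hp _)
           simp [hz, h0]
         · field_simp
           first | done | ring)
  · by_cases h2 : a₂ ∈ W
    · simp only [h1, h2, if_true, if_false]
      have ho := clQ_inter_conn_root_mem ends a₁ a₂ a₃ h2 o
      have hb := clQ_inter_conn_root_mem ends a₁ a₂ a₃ h2 b
      have hjoint : clQ ends a₁ a₂ a₃ W ∩ (connEvent ends a₁ o ∩ connEvent ends a₂ b) =
          if b ∈ W then clQ ends a₁ a₂ a₃ W ∩ connEvent ends a₁ o else ∅ := by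
        rw [← Set.inter_assoc, Set.inter_right_comm, hb]
        split_ifs <;> simp
      have hjoint2 : clQ ends a₁ a₂ a₃ W ∩ (connEvent ends a₂ o ∩ connEvent ends a₁ b) =
          if o ∈ W then clQ ends a₁ a₂ a₃ W ∩ connEvent ends a₁ b else ∅ := by
        rw [← Set.inter_assoc, ho]
        split_ifs <;> simp
      rw [ho, hb, hjoint, hjoint2]
      by_cases hoW : o ∈ W <;> by_cases hbW : b ∈ W <;>
        simp only [hoW, hbW, if_true, if_false, prob_empty, zero_mul, mul_zero, zero_div, add_zero, zero_add] <;>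
        (by_cases hz : prob p (clQ ends a₁ a₂ a₃ W) = 0
         · have h0 : ∀ X : Set (Config E), prob p (clQ ends a₁ a₂ a₃ W ∩ X) = 0 := fun X =>
             le_antisymm (by rw [← hz]; exact prob_mono hp Set.inter_subset_left) (prob_nonneg hp _)
           simp [hz, h0]
         · field_simp
           first | done | ring)
    · simp [h1, h2]

end PerCluster

/-- **`X̂ = Σ_W crossTerm − Σ_W tTerm`**: the mean field is the Rao–Blackwell cross sum minus the `T/T′` corrections. -/
theorem Xhat_eq_cross_sub_t (hp : IsProbVec p) :
    Xhat p ends o a₁ a₂ a₃ b =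
      ∑ W : Finset V, crossTerm p ends o a₁ a₂ a₃ b W - ∑ W : Finset V, tTerm p ends o a₁ a₂ a₃ b W := by
  rw [Xhat_eq_rb p ends o a₁ a₂ a₃ b hp, ← Finset.sum_sub_distrib]
  exact Finset.sum_congr rfl fun W _ => rbTerm_eq ends o a₁ a₂ a₃ b hp W


section Kappa

variable {f : E} {a₃ y : V}

/-- **The (HMF) leaf coefficient as a Rao–Blackwell cross covariance.**  At a leaf `a₃` (edge
`f = {a₃, y}`), on the contracted instance `p[f ↦ 1]`:
`κ = −2 P(T ∪ T′)·C_cross + 2Z·[P(T ∪ T′)·S_T − P(T ∪ T′, oU)·(P(T, bL) + P(T′, bH))]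
     + 2 (B_H − B_L)·[P(T, oU) P(T′) − P(T′, oU) P(T)]`
with `C_cross = Z·Σ_W crossTerm(W) − (A_L B_H + A_H B_L)` (the cleared RB-cross covariances of row 2′RB
along `C(a₃)`) and `S_T = Σ_W tTerm(W)` (the `T/T′` rows). -/
theorem kappa_eq_rbcross (hp : IsProbVec p) (hf : ends f = s(a₃, y))
    (hleaf : ∀ e, a₃ ∈ ends e → e = f) (h3y : a₃ ≠ y) (h31 : a₃ ≠ a₁) (h32 : a₃ ≠ a₂)
    (ho : o ≠ a₃) (hb : b ≠ a₃) :
    4 * HMFc (Function.update p f (1 / 2)) ends o a₁ a₂ a₃ b -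
        2 * HMFc (Function.update p f 1) ends o a₁ a₂ a₃ b =
      -2 * (prob (Function.update p f 1) (TEvent ends a₁ a₂ a₃) +
            prob (Function.update p f 1) (TEvent ends a₂ a₁ a₃)) *
          (prob p (avoidAll ends a₂ {a₁}) *
              ∑ W : Finset V, crossTerm (Function.update p f 1) ends o a₁ a₂ a₃ b W -
            (prob p (avoidAll ends a₂ {a₁} ∩ connEvent ends a₁ o) *
                prob p (avoidAll ends a₂ {a₁} ∩ connEvent ends a₂ b) +
              prob p (avoidAll ends a₂ {a₁} ∩ connEvent ends a₂ o) *
                prob p (avoidAll ends a₂ {a₁} ∩ connEvent ends a₁ b))) +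
        2 * prob p (avoidAll ends a₂ {a₁}) *
          ((prob (Function.update p f 1) (TEvent ends a₁ a₂ a₃) +
                prob (Function.update p f 1) (TEvent ends a₂ a₁ a₃)) *
              ∑ W : Finset V, tTerm (Function.update p f 1) ends o a₁ a₂ a₃ b W -
            (prob (Function.update p f 1) (TEvent ends a₁ a₂ a₃ ∩ connEvent ends a₁ o) +
                prob (Function.update p f 1) (TEvent ends a₁ a₂ a₃ ∩ connEvent ends a₂ o) +
                prob (Function.update p f 1) (TEvent ends a₂ a₁ a₃ ∩ connEvent ends a₁ o) +
                prob (Function.update p f 1) (TEvent ends a₂ a₁ a₃ ∩ connEvent ends a₂ o)) *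
              (prob (Function.update p f 1) (TEvent ends a₁ a₂ a₃ ∩ connEvent ends a₁ b) +
                prob (Function.update p f 1) (TEvent ends a₂ a₁ a₃ ∩ connEvent ends a₂ b))) +
        2 * (prob p (avoidAll ends a₂ {a₁} ∩ connEvent ends a₂ b) -
              prob p (avoidAll ends a₂ {a₁} ∩ connEvent ends a₁ b)) *
          ((prob (Function.update p f 1) (TEvent ends a₁ a₂ a₃ ∩ connEvent ends a₁ o) +
                prob (Function.update p f 1) (TEvent ends a₁ a₂ a₃ ∩ connEvent ends a₂ o)) *
              prob (Function.update p f 1) (TEvent ends a₂ a₁ a₃) -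
            (prob (Function.update p f 1) (TEvent ends a₂ a₁ a₃ ∩ connEvent ends a₁ o) +
                prob (Function.update p f 1) (TEvent ends a₂ a₁ a₃ ∩ connEvent ends a₂ o)) *
              prob (Function.update p f 1) (TEvent ends a₁ a₂ a₃)) := by
  rw [HMFLeafStep.kappa_eq_split p ends hp hf hleaf h3y h31 h32 ho hb,
    Xhat_eq_cross_sub_t (Function.update p f 1) ends o a₁ a₂ a₃ b (hp.update f zero_le_one le_rfl)]
  ring

end Kappa

end XhatRB

end Summit.Ventures.PercRepro2
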